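/-
HONEST FRAMING: certified error envelopes and provably optimal rounding/accumulation schemes for
low-precision formats under stated cost models; every table by two implementations; no hardware
or vendor claims.
-/
import Summits.Ventures.CertifiedArithmetic.LowPrec.OptDemotionRoutingCfgRows

/-!
# The demotion law (Theorem T8), part 11-1: injected options of an ARBITRARY configuration in top-normalised coordinates

For part 11 (the e-side for every popcount, E-SIDE-TOPLEVEL.md): configurations are given by finite
sets of positive OFFSETS (`{0} ∪ {-p : p ∈ T}`), and the partner of an injected option (part 10k-0)
— the complement `C = T ∖ K` together with the injected bit `-q` — is rewritten as `2^-cm` times a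
top-normalised configuration, `cm = min C`:
* `treeBR_shift_offsets` — `BR_t({-q} ∪ -C) = 2^-cm · BR_t({0} ∪ {-(q-cm)} ∪ {-(c-cm) : c ∈ C, c ≠ cm})`;
* `injected_option_ge` — `1 + BR_A({0} ∪ -K) + 2^-cm · BR_B(…) ≤ BR_{A·B}({0} ∪ -T)` for
  `K ⊊ T ⊆ [1, q-1]`, and `injected_option_all_ge` for `K = T` (`+ 2^-q · BR_B{0}`).
The cases `|T| ≤ 3` written out are parts 10h-b/10i-0/10l-0.
-/

namespace Summit.Ventures.CertifiedArithmetic.LowPrec.Opt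

open Literature.ComputerArithmetic.JeannerodRump2018
open Literature.ComputerArithmetic.JeannerodRump2018.SumTree

section CfgShift

variable {q : ℕ}

/-- **SHIFT OF A COMPLEMENT WITH THE INJECTED BIT**: for a nonempty set `C` of offsets with minimum
`cm`, `BR_t({-q} ∪ -C) = 2^-cm · BR_t({0} ∪ {-(q-cm)} ∪ {-(c-cm) : c ∈ C ∖ cm})`. -/
theorem treeBR_shift_offsets (t : SumTree) {C : Finset ℕ} (hne : C.Nonempty) :
    treeBR q t (insert (-(q : ℤ)) (C.image (fun c : ℕ => -(c : ℤ)))) =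
      (2 : ℚ) ^ (-((C.min' hne : ℕ) : ℤ)) *
        treeBR q t (insert 0 (insert (-((q : ℤ) - (C.min' hne : ℕ)))
          ((C.erase (C.min' hne)).image (fun c : ℕ => -((c : ℤ) - (C.min' hne : ℕ)))))) := by
  classical
  set cm := C.min' hne with hcm
  have hcmC : cm ∈ C := Finset.min'_mem C hne
  have h := treeBR_image_add (q := q) t
    (insert 0 (insert (-((q : ℤ) - cm)) ((C.erase cm).image (fun c : ℕ => -((c : ℤ) - cm))))) (-(cm : ℤ))
  have e : (insert 0 (insert (-((q : ℤ) - cm)) ((C.erase cm).image (fun c : ℕ => -((c : ℤ) - cm)))) : Finset ℤ).image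
      (fun e => e + -(cm : ℤ)) = insert (-(q : ℤ)) (C.image (fun c : ℕ => -(c : ℤ))) := by
    ext z
    simp only [Finset.mem_image, Finset.mem_insert, Finset.mem_erase]
    constructor
    · rintro ⟨e, he, rfl⟩
      rcases he with rfl | rfl | ⟨c, ⟨hc1, hc2⟩, rfl⟩
      · right; exact ⟨cm, hcmC, by ring⟩
      · left; ring
      · right; exact ⟨c, hc2, by ring⟩
    · rintro (rfl | ⟨c, hc, rfl⟩)
      · exact ⟨-((q : ℤ) - cm), Or.inr (Or.inl rfl), by ring⟩
      · by_cases hcc : c = cm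
        · subst hcc; exact ⟨0, Or.inl rfl, by ring⟩
        · exact ⟨-((c : ℤ) - cm), Or.inr (Or.inr ⟨c, ⟨hcc, hc⟩, rfl⟩), by ring⟩
  rw [e] at h
  exact h

/-- **A GENERAL INJECTED OPTION, NORMALISED** (part 10k-0 `injected_le_treeBR_node` + the shift): for
offsets `K ⊆ T ⊆ [1, q-1]` with nonempty complement `C = T ∖ K`, `cm = min C`:
`1 + BR_A({0} ∪ -K) + 2^-cm · BR_B({0} ∪ {-(q-cm)} ∪ -(C ∖ cm - cm)) ≤ BR_{A·B}({0} ∪ -T)`. -/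
theorem injected_option_ge (hq : 1 ≤ q) (A B : SumTree) {T K : Finset ℕ} (hT : ∀ p ∈ T, 1 ≤ p ∧ p + 1 ≤ q)
    (hKT : K ⊆ T) (hne : (T \ K).Nonempty) :
    1 + (treeBR q A (insert 0 (K.image (fun p : ℕ => -(p : ℤ)))) +
        (2 : ℚ) ^ (-(((T \ K).min' hne : ℕ) : ℤ)) *
          treeBR q B (insert 0 (insert (-((q : ℤ) - ((T \ K).min' hne : ℕ)))
            (((T \ K).erase ((T \ K).min' hne)).image (fun c : ℕ => -((c : ℤ) - ((T \ K).min' hne : ℕ))))))) ≤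
      treeBR q (.node A B) (insert 0 (T.image (fun p : ℕ => -(p : ℤ)))) := by
  classical
  have hTz : ∀ z ∈ T.image (fun p : ℕ => -(p : ℤ)), 1 - (q : ℤ) ≤ z ∧ z ≤ -1 := by
    intro z hz
    obtain ⟨p, hp, rfl⟩ := Finset.mem_image.1 hz
    have := hT p hp; omega
  have hsub : K.image (fun p : ℕ => -(p : ℤ)) ⊆ T.image (fun p : ℕ => -(p : ℤ)) := Finset.image_subset_image hKT
  have h := injected_le_treeBR_node (q := q) hq A B hTz hsub
  have hinj : Function.Injective (fun p : ℕ => -(p : ℤ)) := fun a b hab => by simpa using hab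
  have e1 : T.image (fun p : ℕ => -(p : ℤ)) \ K.image (fun p : ℕ => -(p : ℤ)) = (T \ K).image (fun p : ℕ => -(p : ℤ)) :=
    (Finset.image_sdiff_of_injOn hinj.injOn hKT).symm
  rw [e1, treeBR_shift_offsets B hne] at h
  exact h

/-- The injected option keeping everything: `1 + BR_A({0} ∪ -T) + 2^-q BR_B{0} ≤ BR_{A·B}({0} ∪ -T)`. -/
theorem injected_option_all_ge (hq : 1 ≤ q) (A B : SumTree) {T : Finset ℕ} (hT : ∀ p ∈ T, 1 ≤ p ∧ p + 1 ≤ q) :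
    1 + (treeBR q A (insert 0 (T.image (fun p : ℕ => -(p : ℤ)))) + (2 : ℚ) ^ (-(q : ℤ)) * treeBR q B {0}) ≤
      treeBR q (.node A B) (insert 0 (T.image (fun p : ℕ => -(p : ℤ)))) := by
  classical
  have hTz : ∀ z ∈ T.image (fun p : ℕ => -(p : ℤ)), 1 - (q : ℤ) ≤ z ∧ z ≤ -1 := by
    intro z hz
    obtain ⟨p, hp, rfl⟩ := Finset.mem_image.1 hz
    have := hT p hp; omega
  have h := injected_le_treeBR_node (q := q) hq A B hTz (subset_refl _)
  rw [Finset.sdiff_self, Finset.insert_empty, treeBR_single_shift] at h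
  exact h

end CfgShift

end Summit.Ventures.CertifiedArithmetic.LowPrec.Opt
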